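import Summits.QuantumFields.BalabanUV.Beta.SecondOrderInverseShape
import Summits.QuantumFields.BalabanUV.Beta.ChartConjugationDefectEnd

/-!
# `BalabanUV.Beta.SecondOrderInverseShapeDefect` — binder row D1, (N7a) of the second-order hR slot port: **THE SIMILARITY SHAPE AT SECOND ORDER
# FOR AN ARBITRARY SPREAD PAIR `(A, 𝕄)` — `K3(A; D♯, W♯) = K3(A; D, W) + conjW A (K2 b) (K2 c) X_b X_c X₂ − A∘R∘A + Δ₃`, WITH THE DEFECT `Δ₃`
# DISPLAYED THROUGH THE SANDWICH DEFECTS `S_X = sandwichDefect A 𝕄 X` OF FIVE LETTERS** (NO inverse relation between `A` and `𝕄`, NO slice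
# projector, NO commutation hypothesis) — the universal form of `SecondOrderInverseShape.K3_sharp_rel`
# (β sub-cell, BINDER-OWNERS row D1 OWNER `b2b-balaban-beta-an2`, gen 31; memo `gen30/N7-SCOPE.v1.md` §4 (N7a), RULING R-D1-g28-2)

HONEST FRAMING (cell charter, verbatim): «discharging BetaPertH makes Bałaban's UV stability UNCONDITIONAL — a real constructive-QFT result; it is
NOT the continuum limit and NOT the Clay problem.»  HONEST DEPENDENCY: continuum YM on T⁴ ⇐ BetaPertH ∧ nine spine estimates (0/9 proved); BetaPertH
⇐ (D1) ∧ (D4) ∧ CAP+tail; G-an2-4 gates asym, D1 and NE2/3/4.  DERIVED cell leaf: NEUTRAL KERNEL ALGEBRA ([folklore]) in the tame currency of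
`TameKernelCalculus` over an5's contacts `conjV`∕`conjW₁`∕`conjW₂`∕`conjW` (`ChartConjugation`) and the NAMED sandwich defect
`ChartConjugationDefectEnd.sandwichDefect A 𝕄 X = (A∘conjV 𝕄 X)∘A + conjV A X` (K4a ∕ K4c); no statement of Bałaban's papers, no `[cite:]`, no `def`,
no `Prop` fact; instantiates no binder of the wall.  NOT D1, NOT `BetaPertH`, NOT continuum, NOT Clay.

WHY (row D1, hR second order, the (0.4)-symmetrised literal «JsB12Sym»).  The comb's second-order reflection induction (`SecondOrderStepEval` →
`SpineRecursiveT2Step` → `SpineRecursiveWEnd`) evaluates `K3OfK` of the ♯-tables through `SecondOrderInverseShape.K3_sharp_rel`, which needs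
`RelInv A 𝕄 E` AND the commutations `E∘X = X∘E` of the three contact generators with the slice projector.  For the symmetrised literal the slice
projector `symEc` is a BLOCK projector and the contact symbols `diagK (γ·ctGenM …)`, `diagK (X2s …)` are NOT block-constant (R-D1-g28-2; an3-g48
THEOREM CX: `[E, X]` has rank 2 at every interior jet bond), so `K3_sharp_rel` does not port.  THIS FILE proves the identity it would give WITHOUT ANY
RELATION between `A` and `𝕄`: the second jet of the `A`-sandwiched ♯-letters inherits the similarity shape EXACTLY UP TO A DISPLAYED DEFECT `Δ₃`, a
seven-word combination of the sandwich defects of the letters `X_b`, `X_c`, `X_b∘X_c`, `X_c∘X_b`, `X₂`: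
  `Δ₃ = S_{X_b}∘(D_c∘A − X_c) + (A∘D♯_b)∘S_{X_c} + S_{X_c}∘(D_b∘A − X_b) + (A∘D♯_c)∘S_{X_b} + S_{X_b∘X_c} + S_{X_c∘X_b} − S_{X₂}`,
`D♯_b = D_b + conjV 𝕄 X_b`.  Under `RelInv A 𝕄 E` every `S_X` is commutator-valued (`ChartConjugationRelativeSX.sandwichDefect_rel`) and vanishes when
`[E, X] = 0` (§5 `sandwichDefect_eq_zero_rel`), recovering `K3_sharp_rel` (closing `example`); under two-sided sockets `S_X = 0`
(`ChartConjugationDefect.sandwichDefect_of_two_sided`).  The instance for the literal (`A := Gsym j`, `𝕄 := bhKStepSh 3 Lc (Dsh Lc) j`) and the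
`mm`-read of `Δ₃` under the tree's block factorisation `bhKStep j ∘ G_j = piKSymBmC` (pattern `RelInvFactorSandwich.mm_sandwich_conjV_diagK`) are
(N7a′)∕(N7b) and NOT here.  An exact-ℚ check of the statement list on random integer matrices (no relation between `A` and `𝕄`; static stdlib engine
`work/toy/k3defect_check.py` of the seat) returns residual 0 for `Δ₃` and a non-zero residual without it — evidence; the theorems below are the
certificate.

## What is here (all abstract: `A 𝕄 : MKer D F` spread; LETTERS `D_b D_c W R` and GENERATORS `X_b X_c X₂` localised; NOTHING ELSE)
* §1 `sandwichDefect_expand` (the four words of `S_X`), **`K2_sharp_defect`**: `−(A∘D♯_b)∘A = K2 b + conjV A X_b − S_{X_b}` (first order).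
* §2 the sandwiched words with defect: `sandwich_K2_defect`, `sandwich_XA_assoc` (pure re-association, the letter `X∘X′` kept sandwiched),
  `sharp_first_factor_comp_defect`, `sandwich_conjW₂_defect`, `sandwich_conjW_defect`.
* §3 **`K3_sharp_defect`** (THE THEOREM).
* §4 **`K3OfK_sharp_split_defect`**: the instantiation at `BalabanStepW2.K3OfK` of the ♯-tables of similarity shape (twin of
  `SecondOrderInverseShape.K3OfK_sharp_split` with the hypotheses `Spr E`, `RelInv K 𝕄 E`, `E`-commutations REMOVED and `Δ₃` displayed).
* §5 junctions: `sandwichDefect_eq_zero_rel`; `K3_sharp_rel` recovered (an `example`).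
Provenance: β sub-cell, unit beta-an2 gen 31, 2026-08-21 (v1); over `TameKernelCalculus`, `ChartConjugation`, `ChartConjugationRelative`,
`ChartConjugationDefect(End)`, `SecondOrderInverseShape` BY NAME; no existing file touched.
-/

open Finset
open scoped BigOperators
open Literature.MathematicalPhysics.QuantumFieldTheory.Balaban1983to89
open Literature.MathematicalPhysics.QuantumFieldTheory.Balaban1983to89.Beta
open ExpKernelCalculus (MKer Decays BiLoc comp)
open OneStepResolventKernel (Fib)
open OneStepKernelFamily (colH)
open SecondOrderResponse (dM K2OfK)
open BalabanStepW2 (K3OfK)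
open Summit.QuantumFields.BalabanUV.Beta.TameKernelCalculus
open Summit.QuantumFields.BalabanUV.Beta.BorderedHessian (diagK)
open Summit.QuantumFields.BalabanUV.Beta.SecondOrderTransport (K2OfK_eq)
open Summit.QuantumFields.BalabanUV.Beta.SecondOrderContactForm (dM_table_sharp_split)
open Summit.QuantumFields.BalabanUV.Beta.ChartConjugation
open Summit.QuantumFields.BalabanUV.Beta.ChartConjugationRelative
open Summit.QuantumFields.BalabanUV.Beta.ChartConjugationDefect (sandwich_defect)
open Summit.QuantumFields.BalabanUV.Beta.ChartConjugationDefectEnd (sandwichDefect sandwichDefect_eq loc_sandwichDefect')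
open Summit.QuantumFields.BalabanUV.Beta.SecondOrderInverseShape (sandwich_conjW₁ K3_sharp_rel)

namespace Summit.QuantumFields.BalabanUV.Beta.SecondOrderInverseShapeDefect

noncomputable section

variable {D : ℕ} {F : Type*} [Fintype F] {A M : MKer D F}

/-! ## §1 The sandwich defect, expanded; the ♯-derivative of the sandwich at first order -/

/-- [folklore] The four words of the sandwich defect: `S_Y = (A∘(𝕄∘Y))∘A − (A∘(Y∘𝕄))∘A + (A∘Y − Y∘A)`. -/
theorem sandwichDefect_expand (hA : Spr A) (hM : Spr M) {Y : MKer D F} (hY : Loc Y) :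
    sandwichDefect A M Y = comp (comp A (comp M Y)) A - comp (comp A (comp Y M)) A + (comp A Y - comp Y A) := by
  rw [sandwichDefect_eq, show conjV M Y = comp M Y - comp Y M from rfl, show conjV A Y = comp A Y - comp Y A from rfl,
    comp_sub_right_tame hA.tame (hM.comp_loc hY).tame (hY.comp_spr hM).tame,
    comp_sub_left_tame (hA.comp_loc (hM.comp_loc hY)).tame (hA.comp_loc (hY.comp_spr hM)).tame hA.tame]

/-- [folklore] **FIRST ORDER, NO INVERSE RELATION**: `−(A∘(D + conjV 𝕄 X))∘A = −(A∘D)∘A + conjV A X − S_X` — the ♯-derivative of the sandwich has the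
similarity shape of the sandwich up to MINUS the sandwich defect (cf. `SecondOrderInverseShape.K2_sharp_rel`, where `S_X = 0`). -/
theorem K2_sharp_defect (hA : Spr A) (hM : Spr M) {Dl X : MKer D F} (hD : Loc Dl) (hX : Loc X) :
    -(comp (comp A (Dl + conjV M X)) A) = -(comp (comp A Dl) A) + conjV A X - sandwichDefect A M X := by
  have hcV : Loc (conjV M X) := loc_conjV hM hX
  rw [sandwichDefect_eq, comp_add_right_tame hA.tame hD.tame hcV.tame,
    comp_add_left_tame (hA.comp_loc hD).tame (hA.comp_loc hcV).tame hA.tame]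
  abel

/-! ## §2 The sandwiched words, with defect -/

section Words

variable (hA : Spr A) (hM : Spr M)
include hA hM

/-- [folklore] `(A∘conjV 𝕄 X)∘((A∘D)∘A) = X∘((A∘D)∘A) − ((A∘X)∘D)∘A + S_X∘(D∘A)` (`ChartConjugationDefect.sandwich_defect` with `Z := D∘A`). -/
theorem sandwich_K2_defect {X Dl : MKer D F} (hX : Loc X) (hD : Loc Dl) :
    comp (comp A (conjV M X)) (comp (comp A Dl) A) =
      comp X (comp (comp A Dl) A) - comp (comp (comp A X) Dl) A + comp (sandwichDefect A M X) (comp Dl A) := by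
  rw [← comp_assoc_tame hA.tame hD.tame hA.tame, sandwich_defect hA hM hX (hD.comp_spr hA),
    comp_assoc_tame (hA.comp_loc hX).tame hD.tame hA.tame, sandwichDefect_eq]

/-- [folklore] `(A∘conjV 𝕄 X)∘(X′∘A) = (A∘(𝕄∘(X∘X′)))∘A − ((A∘X)∘(𝕄∘X′))∘A` — PURE RE-ASSOCIATION (no inverse rule: the letter `X∘X′` stays
sandwiched between `A∘𝕄` and `A`; cf. `SecondOrderInverseShape.sandwich_XA`, which evaluates the first word by the left rule). -/
theorem sandwich_XA_assoc {X Xp : MKer D F} (hX : Loc X) (hXp : Loc Xp) :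
    comp (comp A (conjV M X)) (comp Xp A) = comp (comp A (comp M (comp X Xp))) A - comp (comp (comp A X) (comp M Xp)) A := by
  have hXpA : Loc (comp Xp A) := hXp.comp_spr hA
  have hMX : Loc (comp M X) := hM.comp_loc hX
  have hXM : Loc (comp X M) := hX.comp_spr hM
  have t1 : comp (comp A (comp M X)) (comp Xp A) = comp (comp A (comp M (comp X Xp))) A :=
    calc comp (comp A (comp M X)) (comp Xp A) = comp (comp (comp A (comp M X)) Xp) A :=
          comp_assoc_tame (hA.comp_loc hMX).tame hXp.tame hA.tame
      _ = comp (comp A (comp (comp M X) Xp)) A := by rw [← comp_assoc_tame hA.tame hMX.tame hXp.tame]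
      _ = comp (comp A (comp M (comp X Xp))) A := by rw [← comp_assoc_tame hM.tame hX.tame hXp.tame]
  have t2 : comp (comp A (comp X M)) (comp Xp A) = comp (comp (comp A X) (comp M Xp)) A :=
    calc comp (comp A (comp X M)) (comp Xp A) = comp (comp (comp A X) M) (comp Xp A) := by rw [comp_assoc_tame hA.tame hX.tame hM.tame]
      _ = comp (comp A X) (comp M (comp Xp A)) := (comp_assoc_tame (hA.comp_loc hX).tame hM.tame hXpA.tame).symm
      _ = comp (comp A X) (comp (comp M Xp) A) := by rw [comp_assoc_tame hM.tame hXp.tame hA.tame]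
      _ = comp (comp (comp A X) (comp M Xp)) A := comp_assoc_tame (hA.comp_loc hX).tame (hM.comp_loc hXp).tame hA.tame
  unfold conjV
  rw [comp_sub_right_tame hA.tame hMX.tame hXM.tame,
    comp_sub_left_tame (hA.comp_loc hMX).tame (hA.comp_loc hXM).tame hXpA.tame, t1, t2]

/-- [folklore] **THE ♯-FIRST FACTOR AGAINST THE ♯-DERIVATIVE OF THE SANDWICH, NO INVERSE RELATION**:
`(A∘(D_b + conjV 𝕄 X_b))∘(−(A∘D_c)∘A + conjV A X_c)` expanded into `(A∘D_b)∘(−(A∘D_c)∘A)` + eight words + two sandwich-defect words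
(cf. `SecondOrderInverseShape.sharp_first_factor_comp`: there `S_{X_b} = 0` and `(A∘(𝕄∘(X_b∘X_c)))∘A = (X_b∘X_c)∘A`). -/
theorem sharp_first_factor_comp_defect {Db Dc Xb Xc : MKer D F} (hDb : Loc Db) (hDc : Loc Dc) (hXb : Loc Xb) (hXc : Loc Xc) :
    comp (comp A (Db + conjV M Xb)) (-(comp (comp A Dc) A) + conjV A Xc) =
      comp (comp A Db) (-(comp (comp A Dc) A))
      + (comp (comp (comp A Db) A) Xc - comp (comp (comp A Db) Xc) A)
      + (-(comp Xb (comp (comp A Dc) A)) + comp (comp (comp A Xb) Dc) A)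
      + (comp Xb (comp A Xc) - comp (comp A Xb) Xc - comp (comp A (comp M (comp Xb Xc))) A + comp (comp (comp A Xb) (comp M Xc)) A)
      + (comp (sandwichDefect A M Xb) Xc - comp (sandwichDefect A M Xb) (comp Dc A)) := by
  have hcVb : Loc (conjV M Xb) := loc_conjV hM hXb
  have hcAc : Loc (conjV A Xc) := loc_conjV hA hXc
  have hP : Loc (comp A Db) := hA.comp_loc hDb
  have hQ : Loc (comp A (conjV M Xb)) := hA.comp_loc hcVb
  have hK2c : Loc (comp (comp A Dc) A) := (hA.comp_loc hDc).comp_spr hA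
  -- (i) the plain first factor against the commutator (no rule)
  have e1 : comp (comp A Db) (conjV A Xc) = comp (comp (comp A Db) A) Xc - comp (comp (comp A Db) Xc) A := by
    unfold conjV
    rw [comp_sub_right_tame hP.tame (hA.comp_loc hXc).tame (hXc.comp_spr hA).tame, comp_assoc_tame hP.tame hA.tame hXc.tame,
      comp_assoc_tame hP.tame hXc.tame hA.tame]
  -- (ii) the contact factor against the plain derivative of the sandwich
  have e2 : comp (comp A (conjV M Xb)) (-(comp (comp A Dc) A)) =
      -(comp Xb (comp (comp A Dc) A)) + comp (comp (comp A Xb) Dc) A - comp (sandwichDefect A M Xb) (comp Dc A) := by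
    rw [comp_neg_right, sandwich_K2_defect hA hM hXb hDc]
    abel
  -- (iii) the contact factor against the commutator
  have e3 : comp (comp A (conjV M Xb)) (conjV A Xc) =
      comp Xb (comp A Xc) - comp (comp A Xb) Xc + comp (sandwichDefect A M Xb) Xc - comp (comp A (comp M (comp Xb Xc))) A
        + comp (comp (comp A Xb) (comp M Xc)) A := by
    have h1 : comp (comp A (conjV M Xb)) (comp A Xc) = comp Xb (comp A Xc) - comp (comp A Xb) Xc + comp (sandwichDefect A M Xb) Xc := by
      rw [sandwich_defect hA hM hXb hXc, sandwichDefect_eq]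
    have hc : conjV A Xc = comp A Xc - comp Xc A := rfl
    rw [hc, comp_sub_right_tame hQ.tame (hA.comp_loc hXc).tame (hXc.comp_spr hA).tame, h1, sandwich_XA_assoc hA hM hXb hXc]
    abel
  rw [comp_add_right_tame hA.tame hDb.tame hcVb.tame, comp_add_left_tame hP.tame hQ.tame (hK2c.neg.add hcAc).tame,
    comp_add_right_tame hP.tame hK2c.neg.tame hcAc.tame, comp_add_right_tame hQ.tame hK2c.neg.tame hcAc.tame, e1, e2, e3]
  abel

/-- [folklore] **THE SANDWICH OF THE QUADRATIC PIECE `conjW₂`, NO INVERSE RELATION**: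
`A∘(conjW₂ 𝕄 X_b X_c X₂)∘A = (A∘((X_bX_c)∘𝕄))∘A + (A∘((X_cX_b)∘𝕄))∘A − ((A∘X_b)∘(𝕄∘X_c))∘A − ((A∘X_c)∘(𝕄∘X_b))∘A − conjV A X₂ + S_{X₂}`
(cf. `SecondOrderInverseShape.sandwich_conjW₂`: there the first two words are evaluated by the right rule and `S_{X₂} = 0`). -/
theorem sandwich_conjW₂_defect {Xb Xc X₂ : MKer D F} (hXb : Loc Xb) (hXc : Loc Xc) (hX₂ : Loc X₂) :
    comp (comp A (conjW₂ M Xb Xc X₂)) A =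
      comp (comp A (comp (comp Xb Xc) M)) A + comp (comp A (comp (comp Xc Xb) M)) A
        - (comp (comp (comp A Xb) (comp M Xc)) A + comp (comp (comp A Xc) (comp M Xb)) A)
        - conjV A X₂ + sandwichDefect A M X₂ := by
  have hbc : Loc (comp Xb Xc) := hXb.comp hXc
  have hcb : Loc (comp Xc Xb) := hXc.comp hXb
  have hP : Loc (comp (comp Xb Xc) M + comp (comp Xc Xb) M) := (hbc.comp_spr hM).add (hcb.comp_spr hM)
  have hQ : Loc (comp (comp Xb M) Xc + comp (comp Xc M) Xb) := ((hXb.comp_spr hM).comp hXc).add ((hXc.comp_spr hM).comp hXb)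
  have hRr : Loc (comp M X₂ - comp X₂ M) := (hM.comp_loc hX₂).sub (hX₂.comp_spr hM)
  have eb : comp (comp A (comp (comp Xb M) Xc)) A = comp (comp (comp A Xb) (comp M Xc)) A := by
    rw [comp_assoc_tame hA.tame (hXb.comp_spr hM).tame hXc.tame, comp_assoc_tame hA.tame hXb.tame hM.tame,
      ← comp_assoc_tame (hA.comp_loc hXb).tame hM.tame hXc.tame]
  have eb' : comp (comp A (comp (comp Xc M) Xb)) A = comp (comp (comp A Xc) (comp M Xb)) A := by
    rw [comp_assoc_tame hA.tame (hXc.comp_spr hM).tame hXb.tame, comp_assoc_tame hA.tame hXc.tame hM.tame,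
      ← comp_assoc_tame (hA.comp_loc hXc).tame hM.tame hXb.tame]
  have ec : comp (comp A (comp M X₂ - comp X₂ M)) A = -conjV A X₂ + sandwichDefect A M X₂ := by
    rw [sandwichDefect_eq, show conjV M X₂ = comp M X₂ - comp X₂ M from rfl]
    abel
  unfold conjW₂
  rw [comp_add_right_tame hA.tame (hP.sub hQ).tame hRr.tame, comp_sub_right_tame hA.tame hP.tame hQ.tame,
    comp_add_right_tame hA.tame (hbc.comp_spr hM).tame (hcb.comp_spr hM).tame,
    comp_add_right_tame hA.tame ((hXb.comp_spr hM).comp hXc).tame ((hXc.comp_spr hM).comp hXb).tame,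
    comp_add_left_tame (((hA.comp_loc (hbc.comp_spr hM)).add (hA.comp_loc (hcb.comp_spr hM))).sub
      ((hA.comp_loc ((hXb.comp_spr hM).comp hXc)).add (hA.comp_loc ((hXc.comp_spr hM).comp hXb)))).tame (hA.comp_loc hRr).tame hA.tame,
    comp_sub_left_tame ((hA.comp_loc (hbc.comp_spr hM)).add (hA.comp_loc (hcb.comp_spr hM))).tame
      ((hA.comp_loc ((hXb.comp_spr hM).comp hXc)).add (hA.comp_loc ((hXc.comp_spr hM).comp hXb))).tame hA.tame,
    comp_add_left_tame (hA.comp_loc (hbc.comp_spr hM)).tame (hA.comp_loc (hcb.comp_spr hM)).tame hA.tame,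
    comp_add_left_tame (hA.comp_loc ((hXb.comp_spr hM).comp hXc)).tame (hA.comp_loc ((hXc.comp_spr hM).comp hXb)).tame hA.tame,
    eb, eb', ec]
  abel

/-- [folklore] **THE SANDWICH OF THE FULL SECOND-ORDER CONTACT, NO INVERSE RELATION** `A∘(conjW 𝕄 D_b D_c X_b X_c X₂)∘A`, expanded
(`SecondOrderInverseShape.sandwich_conjW₁` + `sandwich_conjW₂_defect`). -/
theorem sandwich_conjW_defect {Db Dc Xb Xc X₂ : MKer D F} (hDb : Loc Db) (hDc : Loc Dc) (hXb : Loc Xb) (hXc : Loc Xc) (hX₂ : Loc X₂) :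
    comp (comp A (conjW M Db Dc Xb Xc X₂)) A =
      comp (comp (comp A Dc) Xb) A - comp (comp (comp A Xb) Dc) A + (comp (comp (comp A Db) Xc) A - comp (comp (comp A Xc) Db) A)
      + (comp (comp A (comp (comp Xb Xc) M)) A + comp (comp A (comp (comp Xc Xb) M)) A
        - (comp (comp (comp A Xb) (comp M Xc)) A + comp (comp (comp A Xc) (comp M Xb)) A)
        - conjV A X₂ + sandwichDefect A M X₂) := by
  have h1 : Loc (conjW₁ Db Dc Xb Xc) := loc_conjW₁ hDb hDc hXb hXc
  have h2 : Loc (conjW₂ M Xb Xc X₂) := loc_conjW₂ hM hXb hXc hX₂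
  unfold conjW
  rw [comp_add_right_tame hA.tame h1.tame h2.tame, comp_add_left_tame (hA.comp_loc h1).tame (hA.comp_loc h2).tame hA.tame,
    sandwich_conjW₁ hA hDb hDc hXb hXc, sandwich_conjW₂_defect hA hM hXb hXc hX₂]

end Words

/-! ## §3 The theorem: the similarity shape at second order, with its defect -/

/-- [folklore] **THE SIMILARITY SHAPE PASSES TO THE SANDWICH AT SECOND ORDER UP TO THE DISPLAYED DEFECT `Δ₃` — NO INVERSE RELATION.**  For spread
`A`, `𝕄` (NOTHING assumed between them), localised letters `D_b, D_c, W, R` and localised generators `X_b, X_c, X₂`: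
`K3(A; D♯, W♯) = K3(A; D, W) + conjW A (K2 b) (K2 c) X_b X_c X₂ − (A∘R)∘A + Δ₃`,
`Δ₃ = S_{X_b}∘(D_c∘A − X_c) + (A∘D♯_b)∘S_{X_c} + S_{X_c}∘(D_b∘A − X_b) + (A∘D♯_c)∘S_{X_b} + S_{X_b∘X_c} + S_{X_c∘X_b} − S_{X₂}`,
where `K2 b := −(A∘D_b)∘A`, `K3(A; D, W) := −(A∘D_b)∘(K2 c) − (A∘D_c)∘(K2 b) − (A∘W)∘A`, `D♯_b := D_b + conjV 𝕄 X_b`,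
`W♯ := W + conjW 𝕄 D_b D_c X_b X_c X₂ + R`, `S_X := sandwichDefect A 𝕄 X = (A∘conjV 𝕄 X)∘A + conjV A X`.
With `RelInv A 𝕄 E` and `[E, X] = 0` for the three generators every `S_X` vanishes (§5) and this is `SecondOrderInverseShape.K3_sharp_rel`. -/
theorem K3_sharp_defect (hA : Spr A) (hM : Spr M) {Db Dc W R Xb Xc X₂ : MKer D F}
    (hDb : Loc Db) (hDc : Loc Dc) (hW : Loc W) (hRm : Loc R) (hXb : Loc Xb) (hXc : Loc Xc) (hX₂ : Loc X₂) :
    -(comp (comp A (Db + conjV M Xb)) (-(comp (comp A (Dc + conjV M Xc)) A)))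
      - comp (comp A (Dc + conjV M Xc)) (-(comp (comp A (Db + conjV M Xb)) A))
      - comp (comp A (W + conjW M Db Dc Xb Xc X₂ + R)) A =
    (-(comp (comp A Db) (-(comp (comp A Dc) A))) - comp (comp A Dc) (-(comp (comp A Db) A)) - comp (comp A W) A)
      + conjW A (-(comp (comp A Db) A)) (-(comp (comp A Dc) A)) Xb Xc X₂ - comp (comp A R) A
      + (comp (sandwichDefect A M Xb) (comp Dc A - Xc) + comp (comp A (Db + conjV M Xb)) (sandwichDefect A M Xc)
        + comp (sandwichDefect A M Xc) (comp Db A - Xb) + comp (comp A (Dc + conjV M Xc)) (sandwichDefect A M Xb)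
        + sandwichDefect A M (comp Xb Xc) + sandwichDefect A M (comp Xc Xb) - sandwichDefect A M X₂) := by
  have hcW : Loc (conjW M Db Dc Xb Xc X₂) := loc_conjW hM hDb hDc hXb hXc hX₂
  have hcVb : Loc (conjV M Xb) := loc_conjV hM hXb
  have hcVc : Loc (conjV M Xc) := loc_conjV hM hXc
  have hSb : Loc (sandwichDefect A M Xb) := loc_sandwichDefect' hA hM hXb
  have hSc : Loc (sandwichDefect A M Xc) := loc_sandwichDefect' hA hM hXc
  have hPb : Loc (-(comp (comp A Db) A) + conjV A Xb) := ((hA.comp_loc hDb).comp_spr hA).neg.add (loc_conjV hA hXb)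
  have hPc : Loc (-(comp (comp A Dc) A) + conjV A Xc) := ((hA.comp_loc hDc).comp_spr hA).neg.add (loc_conjV hA hXc)
  have hTb : Tame (comp A (Db + conjV M Xb)) := (hA.comp_loc (hDb.add hcVb)).tame
  have hTc : Tame (comp A (Dc + conjV M Xc)) := (hA.comp_loc (hDc.add hcVc)).tame
  rw [K2_sharp_defect hA hM hDc hXc, K2_sharp_defect hA hM hDb hXb,
    comp_sub_right_tame hTb hPc.tame hSc.tame, comp_sub_right_tame hTc hPb.tame hSb.tame,
    sharp_first_factor_comp_defect hA hM hDb hDc hXb hXc, sharp_first_factor_comp_defect hA hM hDc hDb hXc hXb,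
    comp_add_right_tame hA.tame (hW.add hcW).tame hRm.tame, comp_add_right_tame hA.tame hW.tame hcW.tame,
    comp_add_left_tame ((hA.comp_loc hW).add (hA.comp_loc hcW)).tame (hA.comp_loc hRm).tame hA.tame,
    comp_add_left_tame (hA.comp_loc hW).tame (hA.comp_loc hcW).tame hA.tame,
    sandwich_conjW_defect hA hM hDb hDc hXb hXc hX₂,
    comp_sub_right_tame hSb.tame (hDc.comp_spr hA).tame hXc.tame, comp_sub_right_tame hSc.tame (hDb.comp_spr hA).tame hXb.tame,
    sandwichDefect_expand hA hM (Y := comp Xb Xc) (hXb.comp hXc), sandwichDefect_expand hA hM (Y := comp Xc Xb) (hXc.comp hXb),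
    ← comp_assoc_tame hA.tame hXb.tame hXc.tame, ← comp_assoc_tame hA.tame hXc.tame hXb.tame,
    comp_assoc_tame hXb.tame hA.tame hXc.tame, comp_assoc_tame hXc.tame hA.tame hXb.tame]
  unfold conjW conjW₁ conjW₂ conjV
  simp only [comp_neg_left, comp_neg_right]
  abel

/-! ## §4 The instantiation: `K3OfK` of the ♯-tables of similarity shape, no inverse relation -/

section Tables

variable {d N : ℕ}

/-- [folklore] **`K3OfK` OF THE ♯-TABLES IN CLOSED FORM, NO INVERSE RELATION** (twin of `SecondOrderInverseShape.K3OfK_sharp_split` with `Spr E`,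
`RelInv K 𝕄 E` and the three `E`-commutations REMOVED).  For spread packed kernels `K`, `𝕄`, first-order tables `S`, `M` with the diagonal-contact
♯-table `S♯ κ u := S κ u + conjV 𝕄 (diagK (g κ u))`, and a second-order table whose ♯-bi-table is of SIMILARITY SHAPE UP TO A REMAINDER,
`W♯ b c := W b c + conjW 𝕄 (dM K N S M b) (dM K N S M c) (diagK (G b)) (diagK (G c)) (X₂ b c) + R b c` (`G b` = `g` dressed by `colH K N b`):
`K3OfK K N S♯ M W♯ b c = K3OfK K N S M W b c + conjW K (K2OfK K N S M b) (K2OfK K N S M c) (diagK (G b)) (diagK (G c)) (X₂ b c) − K∘(R b c)∘K + Δ₃`,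
`Δ₃` = `K3_sharp_defect`'s defect at `A := K`, `D_b := dM K N S M b`, `X_b := diagK (G b)`, `X₂ := X₂ b c`.  Entrywise column summabilities and
localisations are the ONLY hypotheses. -/
theorem K3OfK_sharp_split_defect {K 𝕄 : MKer (d + 1) (Fib d)} (hKs : Spr K) (h𝕄 : Spr 𝕄)
    {S M : Fin (d + 1) → (Fin (d + 1) → ℤ) → MKer (d + 1) (Fib d)}
    {g : Fin (d + 1) → (Fin (d + 1) → ℤ) → (Fin (d + 1) → ℤ) → Fib d → ℝ}
    {W R X₂ : Fin (d + 1) → (Fin (d + 1) → ℤ) → Fin (d + 1) → (Fin (d + 1) → ℤ) → MKer (d + 1) (Fib d)}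
    (μ : Fin (d + 1)) (y : Fin (d + 1) → ℤ) (ν : Fin (d + 1)) (y' : Fin (d + 1) → ℤ)
    (hS : ∀ (μ : Fin (d + 1)) (y : Fin (d + 1) → ℤ) (κ : Fin (d + 1)) (x z : Fin (d + 1) → ℤ) (a b : Fib d),
      Summable fun u => colH K N μ y κ u * S κ u x z a b)
    (hg : ∀ (μ : Fin (d + 1)) (y : Fin (d + 1) → ℤ) (κ : Fin (d + 1)) (p : Fin (d + 1) → ℤ) (c : Fib d),
      Summable fun u => colH K N μ y κ u * g κ u p c)
    (hDb : Loc (dM K N S M μ y)) (hDc : Loc (dM K N S M ν y')) (hW : Loc (W μ y ν y')) (hRm : Loc (R μ y ν y'))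
    (hGb : Loc (diagK fun p c => ∑ κ, ∑' u, colH K N μ y κ u * g κ u p c))
    (hGc : Loc (diagK fun p c => ∑ κ, ∑' u, colH K N ν y' κ u * g κ u p c)) (hX₂ : Loc (X₂ μ y ν y')) :
    K3OfK K N (fun κ u => S κ u + conjV 𝕄 (diagK (g κ u))) M
        (fun μ y ν y' => W μ y ν y' +
          conjW 𝕄 (dM K N S M μ y) (dM K N S M ν y') (diagK fun p c => ∑ κ, ∑' u, colH K N μ y κ u * g κ u p c)
            (diagK fun p c => ∑ κ, ∑' u, colH K N ν y' κ u * g κ u p c) (X₂ μ y ν y') + R μ y ν y') μ y ν y' =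
      K3OfK K N S M W μ y ν y' +
        conjW K (K2OfK K N S M μ y) (K2OfK K N S M ν y') (diagK fun p c => ∑ κ, ∑' u, colH K N μ y κ u * g κ u p c)
          (diagK fun p c => ∑ κ, ∑' u, colH K N ν y' κ u * g κ u p c) (X₂ μ y ν y') - comp (comp K (R μ y ν y')) K
        + (comp (sandwichDefect K 𝕄 (diagK fun p c => ∑ κ, ∑' u, colH K N μ y κ u * g κ u p c))
              (comp (dM K N S M ν y') K - diagK fun p c => ∑ κ, ∑' u, colH K N ν y' κ u * g κ u p c)
          + comp (comp K (dM K N S M μ y + conjV 𝕄 (diagK fun p c => ∑ κ, ∑' u, colH K N μ y κ u * g κ u p c)))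
              (sandwichDefect K 𝕄 (diagK fun p c => ∑ κ, ∑' u, colH K N ν y' κ u * g κ u p c))
          + comp (sandwichDefect K 𝕄 (diagK fun p c => ∑ κ, ∑' u, colH K N ν y' κ u * g κ u p c))
              (comp (dM K N S M μ y) K - diagK fun p c => ∑ κ, ∑' u, colH K N μ y κ u * g κ u p c)
          + comp (comp K (dM K N S M ν y' + conjV 𝕄 (diagK fun p c => ∑ κ, ∑' u, colH K N ν y' κ u * g κ u p c)))
              (sandwichDefect K 𝕄 (diagK fun p c => ∑ κ, ∑' u, colH K N μ y κ u * g κ u p c))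
          + sandwichDefect K 𝕄 (comp (diagK fun p c => ∑ κ, ∑' u, colH K N μ y κ u * g κ u p c)
              (diagK fun p c => ∑ κ, ∑' u, colH K N ν y' κ u * g κ u p c))
          + sandwichDefect K 𝕄 (comp (diagK fun p c => ∑ κ, ∑' u, colH K N ν y' κ u * g κ u p c)
              (diagK fun p c => ∑ κ, ∑' u, colH K N μ y κ u * g κ u p c))
          - sandwichDefect K 𝕄 (X₂ μ y ν y')) := by
  have eL : K3OfK K N (fun κ u => S κ u + conjV 𝕄 (diagK (g κ u))) M
        (fun μ y ν y' => W μ y ν y' +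
          conjW 𝕄 (dM K N S M μ y) (dM K N S M ν y') (diagK fun p c => ∑ κ, ∑' u, colH K N μ y κ u * g κ u p c)
            (diagK fun p c => ∑ κ, ∑' u, colH K N ν y' κ u * g κ u p c) (X₂ μ y ν y') + R μ y ν y') μ y ν y' =
      -(comp (comp K (dM K N (fun κ u => S κ u + conjV 𝕄 (diagK (g κ u))) M μ y))
          (K2OfK K N (fun κ u => S κ u + conjV 𝕄 (diagK (g κ u))) M ν y')) -
        comp (comp K (dM K N (fun κ u => S κ u + conjV 𝕄 (diagK (g κ u))) M ν y'))
          (K2OfK K N (fun κ u => S κ u + conjV 𝕄 (diagK (g κ u))) M μ y) -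
        comp (comp K (W μ y ν y' +
          conjW 𝕄 (dM K N S M μ y) (dM K N S M ν y') (diagK fun p c => ∑ κ, ∑' u, colH K N μ y κ u * g κ u p c)
            (diagK fun p c => ∑ κ, ∑' u, colH K N ν y' κ u * g κ u p c) (X₂ μ y ν y') + R μ y ν y')) K := by
    funext x z a b; rfl
  have eR : K3OfK K N S M W μ y ν y' =
      -(comp (comp K (dM K N S M μ y)) (K2OfK K N S M ν y')) - comp (comp K (dM K N S M ν y')) (K2OfK K N S M μ y) -
        comp (comp K (W μ y ν y')) K := by
    funext x z a b; rfl
  rw [eL, eR, K2OfK_eq, K2OfK_eq, K2OfK_eq, K2OfK_eq, dM_table_sharp_split N 𝕄 K S M μ y (hS μ y) hg,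
    dM_table_sharp_split N 𝕄 K S M ν y' (hS ν y') hg]
  exact K3_sharp_defect hKs h𝕄 hDb hDc hW hRm hGb hGc hX₂

end Tables

/-! ## §5 Junctions: the relative sockets kill every sandwich defect; `K3_sharp_rel` recovered -/

section Junction

variable {E : MKer D F}

/-- [folklore] Over `RelInv A 𝕄 E`, a localised `X` commuting with `E` has NO sandwich defect: `S_X = 0` (`RelInvSandwich.sandwich_conjV_rel`). -/
theorem sandwichDefect_eq_zero_rel (hA : Spr A) (hM : Spr M) (hE : Spr E) (hR : RelInv A M E) {X : MKer D F} (hX : Loc X)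
    (hEX : comp E X = comp X E) : sandwichDefect A M X = 0 := by
  rw [sandwichDefect_eq, sandwich_conjV_rel hA hM hE hR hX hEX, neg_add_cancel]

/-- JUNCTION: `SecondOrderInverseShape.K3_sharp_rel` RECOVERED from `K3_sharp_defect` (an `example`, so that nothing of the tree is re-declared):
under `RelInv A 𝕄 E` and the three commutations every one of the five sandwich defects vanishes. -/
example (hA : Spr A) (hM : Spr M) (hE : Spr E) (hR : RelInv A M E) {Db Dc W R Xb Xc X₂ : MKer D F}
    (hDb : Loc Db) (hDc : Loc Dc) (hW : Loc W) (hRm : Loc R) (hXb : Loc Xb) (hXc : Loc Xc) (hX₂ : Loc X₂)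
    (hEXb : comp E Xb = comp Xb E) (hEXc : comp E Xc = comp Xc E) (hEX₂ : comp E X₂ = comp X₂ E) :
    -(comp (comp A (Db + conjV M Xb)) (-(comp (comp A (Dc + conjV M Xc)) A)))
      - comp (comp A (Dc + conjV M Xc)) (-(comp (comp A (Db + conjV M Xb)) A))
      - comp (comp A (W + conjW M Db Dc Xb Xc X₂ + R)) A =
    (-(comp (comp A Db) (-(comp (comp A Dc) A))) - comp (comp A Dc) (-(comp (comp A Db) A)) - comp (comp A W) A)
      + conjW A (-(comp (comp A Db) A)) (-(comp (comp A Dc) A)) Xb Xc X₂ - comp (comp A R) A := by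
  have hc0 : ∀ Z : MKer D F, comp (0 : MKer D F) Z = 0 := fun Z => by
    funext x z a b
    simp only [ExpKernelCalculus.comp, Pi.zero_apply, zero_mul, Finset.sum_const_zero, tsum_zero]
  rw [K3_sharp_defect hA hM hDb hDc hW hRm hXb hXc hX₂, sandwichDefect_eq_zero_rel hA hM hE hR hXb hEXb,
    sandwichDefect_eq_zero_rel hA hM hE hR hXc hEXc, sandwichDefect_eq_zero_rel hA hM hE hR hX₂ hEX₂,
    sandwichDefect_eq_zero_rel hA hM hE hR (hXb.comp hXc) (comm_comp hE hXb hXc hEXb hEXc),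
    sandwichDefect_eq_zero_rel hA hM hE hR (hXc.comp hXb) (comm_comp hE hXc hXb hEXc hEXb),
    hc0, hc0, StepDriftWitness.comp_zero_right, StepDriftWitness.comp_zero_right]
  abel

end Junction

end

end Summit.QuantumFields.BalabanUV.Beta.SecondOrderInverseShapeDefect
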